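import Mathlib
import Literature.Analysis.OperatorTheory.ContractiveDeterminantalRepresentation
import Literature.Analysis.OperatorTheory.ContractiveDeterminantalRepresentationProofs
import HarnessLib

/-!
# The reflection identity `z^n p̄(1/z) = det(Z_n − K^*)` and pencil API for `det(I − K Z_n)`

Topic `Literature/Analysis/OperatorTheory`; companion of `ContractiveDeterminantalRepresentation`
(vocabulary of Grinshpan–Kaliuzhnyi-Verbovetskyi–Woerdeman, *Norm-constrained determinantal
representations of multivariable polynomials*, Complex Anal. Oper. Theory 7 (2013) =
arXiv:1208.2288 [GrinshpanKaliuzhnyiverbovetsWoerdeman2012]: `blockVar κ = Z_n`,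
`gkvwDet κ K = det(I − K Z_n)`, `blockOrder κ = n`, `conjReverse n p = z^n p̄(1/z)`, `IsRealizedBy`).
Requested by the line `birth` of crux `ValiantsHypothesis/ContractivityPrice.ContractiveHardness`
(stubs `stub_priceOfUnitarity`, `stub_defectOneMultiplesHard`), whose workers proved these pieces.

## Contents (theorems only)
* `degrees_gkvwDet_le`, `le_blockOrder_of_mem_support_gkvwDet`: every exponent of `det(I − K Z_n)`
  is `≤ n` (so `conjReverse (blockOrder κ)` is the faithful reflection, no truncated subtraction);
* `eval_conjReverse`, `prod_blockOrder_pow`, `eval_gkvwDet`, `eval_det_blockVar_sub`,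
  `star_det_one_sub_mul_diagonal`, `prod_mul_det_one_sub_eq`: evaluation lemmas;
* `conjReverse_blockOrder_gkvwDet` — **[GKVW 2012, (5.5)]** (proof of Thm. 5.2, p. 10):
  `z^n p̄(1/z) = z^n det(I − K̄ Z_n⁻¹) = det(Z_n − K̄) = det(Z_n − K^*)` for `p = det(I − K Z_n)`,
  as the polynomial identity `conjReverse (blockOrder κ) (gkvwDet κ K) = det(blockVar κ − Kᴴ)`;
* `isRealizedBy_fin_zero_iff`: order-zero realizations are constants `num = den · U₀₀`;
* `toBlocks₂₂_defect_eq`, `toBlocks₂₂_defect_eq'`: for a UNITARY `U = [[A, B], [C, D]]` on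
  `ℂ ⊕ ℂ^{R'}`, `I − D^*D = B^*B` and `I − DD^* = CC^*` — the state operator of a unitary
  realization with one-dimensional input/output is a contraction of DEFECT ≤ 1;
* `gkvwDet_eq_rename`, `vars_gkvwDet_subset_image`, `mem_range_of_mem_vars_gkvwDet`:
  `det(I − K Z_κ)` only involves the variables in the range of `κ`; `vars_subset_vars_of_dvd`
  (over `ℂ`, a divisor of a nonzero polynomial involves only its variables).

Not here: Theorem 5.2 itself (needs the Schur–Agler class, route definition request D2).
-/

noncomputable section

namespace Literature.Analysis.OperatorTheory

open MvPolynomial Matrix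

variable {σ : Type*} {R : ℕ}

/-! ## Exponents of `det(I − K Z_n)` are bounded by `n` -/

/-- `deg det(I − K Z_n) ≤ n` componentwise (column `j` of `K Z_n` only involves `z_{κ j}`,
linearly). [folklore] -/
theorem degrees_gkvwDet_le [DecidableEq σ] (κ : Fin R → σ) (K : Matrix (Fin R) (Fin R) ℂ) :
    (gkvwDet κ K).degrees ≤ Finsupp.toMultiset (blockOrder κ) := by
  have hτ : Finsupp.toMultiset (blockOrder κ) = ∑ j : Fin R, ({κ j} : Multiset σ) := by
    rw [blockOrder, Finsupp.toMultiset_sum]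
    simp
  rw [gkvwDet, hτ]
  refine degrees_det_le_sum _ _ fun i j => ?_
  simp only [Matrix.sub_apply, blockVar, Matrix.mul_diagonal, Matrix.map_apply]
  refine (degrees_sub_le).trans (sup_le ?_ ?_)
  · rw [Matrix.one_apply]
    split_ifs <;> simp
  · exact degrees_mul_le.trans (by simp [degrees_C])

/-- Every exponent of `det(I − K Z_n)` is `≤ n = blockOrder κ` (so `conjReverse (blockOrder κ)` is
the faithful reflection `z^n p̄(1/z)`, no truncated subtraction). [folklore] -/
theorem le_blockOrder_of_mem_support_gkvwDet {κ : Fin R → σ} {K : Matrix (Fin R) (Fin R) ℂ}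
    {α : σ →₀ ℕ} (hα : α ∈ (gkvwDet κ K).support) : α ≤ blockOrder κ := by
  classical
  have h1 : Finsupp.toMultiset α ≤ (gkvwDet κ K).degrees := by
    rw [degrees_def]
    exact Finset.le_sup (f := fun s : σ →₀ ℕ => Finsupp.toMultiset s) hα
  exact toMultiset_le_toMultiset.mp (h1.trans (degrees_gkvwDet_le κ K))

/-! ## Evaluating the reflection away from the coordinate hyperplanes -/

/-- `(z^n p̄(1/z))(z) = z^n · conj (p (1/ z̄))` at points with all coordinates non-zero, for `p` of
multidegree `≤ n`. [folklore] -/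
theorem eval_conjReverse {n : σ →₀ ℕ} {p : MvPolynomial σ ℂ} (h : ∀ α ∈ p.support, α ≤ n)
    {z : σ → ℂ} (hz : ∀ j, z j ≠ 0) :
    eval z (conjReverse n p) =
      (n.prod fun j e => z j ^ e) *
        starRingEnd ℂ (eval (fun j => (starRingEnd ℂ (z j))⁻¹) p) := by
  unfold conjReverse
  rw [map_sum, eval_eq, map_sum, Finset.mul_sum]
  refine Finset.sum_congr rfl fun α hα => ?_
  have hle : α ≤ n := h α hα
  rw [eval_monomial, map_mul, map_prod]
  simp_rw [map_pow, map_inv₀, starRingEnd_self_apply]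
  have hsub1 : (n - α).support ⊆ n.support := by
    intro j hj
    rw [Finsupp.mem_support_iff] at hj ⊢
    intro h0
    apply hj
    rw [Finsupp.tsub_apply, h0, Nat.zero_sub]
  have hsub2 : α.support ⊆ n.support := by
    intro j hj
    rw [Finsupp.mem_support_iff] at hj ⊢
    intro h0
    exact hj (Nat.eq_zero_of_le_zero (h0 ▸ hle j))
  rw [Finsupp.prod_of_support_subset _ hsub1 _ (fun _ _ => pow_zero _),
    Finset.prod_subset hsub2 (fun j _ hj => by rw [Finsupp.notMem_support_iff.mp hj, pow_zero]),
    Finsupp.prod]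
  simp_rw [Finsupp.tsub_apply]
  have hpt : ∀ j ∈ n.support, z j ^ (n j - α j) = z j ^ n j * ((z j)⁻¹) ^ (α j) := fun j _ => by
    rw [pow_sub₀ _ (hz j) (hle j), inv_pow]
  rw [Finset.prod_congr rfl hpt, Finset.prod_mul_distrib]
  ring

/-- `z^n = ∏_i z_{κ i}` for `n = blockOrder κ`. [folklore] -/
theorem prod_blockOrder_pow (κ : Fin R → σ) (z : σ → ℂ) :
    ((blockOrder κ).prod fun j e => z j ^ e) = ∏ i, z (κ i) := by
  have h := eval_monomial (f := z) (s := blockOrder κ) (a := (1 : ℂ))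
  rw [one_mul] at h
  rw [← h, blockOrder, monomial_sum_one, map_prod]
  refine Finset.prod_congr rfl fun i _ => ?_
  rw [← X, eval_X]  -- `X j = monomial (single j 1) 1`

/-- `p(z) = det(I − K diag(z ∘ κ))` for `p = det(I − K Z_n)`. [folklore] -/
theorem eval_gkvwDet (κ : Fin R → σ) (K : Matrix (Fin R) (Fin R) ℂ) (z : σ → ℂ) :
    eval z (gkvwDet κ K) = (1 - K * Matrix.diagonal (fun i => z (κ i))).det := by
  rw [gkvwDet, RingHom.map_det, RingHom.mapMatrix_apply]
  congr 1
  ext i j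
  simp [blockVar, Matrix.mul_diagonal, Matrix.one_apply]

/-- Evaluation of `det(Z_n − K^*)`. [folklore] -/
theorem eval_det_blockVar_sub (κ : Fin R → σ) (K : Matrix (Fin R) (Fin R) ℂ) (z : σ → ℂ) :
    eval z ((blockVar κ - Kᴴ.map C).det) = (Matrix.diagonal (fun i => z (κ i)) - Kᴴ).det := by
  rw [RingHom.map_det, RingHom.mapMatrix_apply]
  congr 1
  ext i j
  simp only [Matrix.map_apply, Matrix.sub_apply, blockVar_apply, Matrix.diagonal_apply,
    conjTranspose_apply, map_sub, eval_C]
  split_ifs <;> simp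

/-- `conj det(I − K diag(w)) = det(I − K̄ diag(w̄))`. [folklore] -/
theorem star_det_one_sub_mul_diagonal (K : Matrix (Fin R) (Fin R) ℂ) (w : Fin R → ℂ) :
    starRingEnd ℂ ((1 - K * diagonal w).det) =
      (1 - K.map (starRingEnd ℂ) * diagonal (fun i => starRingEnd ℂ (w i))).det := by
  rw [RingHom.map_det, RingHom.mapMatrix_apply]
  congr 1
  ext i j
  simp [Matrix.mul_diagonal, Matrix.one_apply]

/-- `det(D) · det(I − K̄ D⁻¹) = det(D − K^*)` for an invertible diagonal `D` (GKVW, (5.5): uses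
`Z_nᵀ = Z_n`). [folklore] -/
theorem prod_mul_det_one_sub_eq (K : Matrix (Fin R) (Fin R) ℂ) (d : Fin R → ℂ) (hd : ∀ i, d i ≠ 0) :
    (∏ i, d i) * (1 - K.map (starRingEnd ℂ) * diagonal (fun i => (d i)⁻¹)).det =
      (diagonal d - Kᴴ).det := by
  rw [← det_diagonal, mul_comm, ← det_mul]
  have hmul : (1 - K.map (starRingEnd ℂ) * diagonal (fun i => (d i)⁻¹)) * diagonal d =
      diagonal d - K.map (starRingEnd ℂ) := by
    rw [sub_mul, one_mul, Matrix.mul_assoc, diagonal_mul_diagonal]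
    have h1 : (diagonal fun i => (d i)⁻¹ * d i) = (1 : Matrix (Fin R) (Fin R) ℂ) := by
      have : (fun i => (d i)⁻¹ * d i) = fun _ => (1 : ℂ) := funext fun i => inv_mul_cancel₀ (hd i)
      rw [this, diagonal_one]
    rw [h1, Matrix.mul_one]
  rw [hmul, ← det_transpose, transpose_sub, diagonal_transpose]
  rfl

/-- **GKVW 2012, (5.5)**: `z^n p̄(1/z) = det(Z_n − K^*)` for `p = det(I_{|n|} − K Z_n)`, as an
identity of polynomials: `conjReverse (blockOrder κ) (gkvwDet κ K) = det(blockVar κ − Kᴴ)`.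
[cite: GrinshpanKaliuzhnyiverbovetsWoerdeman2012, proof of Thm. 5.2, (5.5)] -/
theorem conjReverse_blockOrder_gkvwDet (κ : Fin R → σ) (K : Matrix (Fin R) (Fin R) ℂ) :
    conjReverse (blockOrder κ) (gkvwDet κ K) = (blockVar κ - Kᴴ.map C).det := by
  refine MvPolynomial.funext_set (fun _ : σ => ({0}ᶜ : Set ℂ))
    (fun _ => (Set.finite_singleton (0 : ℂ)).infinite_compl) ?_
  intro z hz
  have hz' : ∀ j, z j ≠ 0 := fun j => by
    have := hz j (Set.mem_univ j)
    simpa using this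
  rw [eval_conjReverse (fun α hα => le_blockOrder_of_mem_support_gkvwDet hα) hz', eval_gkvwDet,
    eval_det_blockVar_sub, prod_blockOrder_pow, star_det_one_sub_mul_diagonal]
  simp_rw [map_inv₀, starRingEnd_self_apply]
  exact prod_mul_det_one_sub_eq K (fun i => z (κ i)) (fun i => hz' (κ i))

/-- With no state space (`R' = 0`) the realization identity `num/den = A + B Z (I − D Z)⁻¹ C`
degenerates to `num = den · U₀₀`. [folklore] -/
theorem isRealizedBy_fin_zero_iff (κ' : Fin 0 → σ) (U : Matrix (Fin 1 ⊕ Fin 0) (Fin 1 ⊕ Fin 0) ℂ)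
    (num den : MvPolynomial σ ℂ) :
    IsRealizedBy κ' U num den ↔ num = den * C (U (Sum.inl 0) (Sum.inl 0)) := by
  simp [IsRealizedBy, Matrix.det_fin_zero, Matrix.mul_apply, Matrix.toBlocks₁₁]


/-! ## The defect constraint on the state operator of a unitary realization

If `U = [[A, B], [C, D]]` is unitary with a ONE-dimensional input/output space, then
`I − D^*D = B^*B` and `I − DD^* = CC^*` have rank `≤ 1`: the state operator `D` (which, by the
argument of GKVW Thm. 5.6, is the matrix `K` of a contractive determinantal representation of
`den · q`) is a contraction of DEFECT `≤ 1`.  So "price of unitarity zero" for `p = det(I − K Z_n)`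
means: `p` has a contractive determinantal representation OF THE SAME STRUCTURE by a defect-`≤ 1`
contraction; GKVW Rem. 5.10 (`p = 1 − (z₁+z₂+z₃)/3`) is a `p` with none. -/

/-- For a unitary `U = [[A, B], [C, D]]` on `ℂ ⊕ ℂ^{R'}`: `B^*B + D^*D = I`, i.e. the defect
`I − D^*D = B^*B` of the state operator has rank at most one. [folklore] -/
theorem toBlocks₂₂_defect_eq {R' : ℕ} {U : Matrix (Fin 1 ⊕ Fin R') (Fin 1 ⊕ Fin R') ℂ}
    (hU : U ∈ Matrix.unitaryGroup (Fin 1 ⊕ Fin R') ℂ) :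
    1 - (U.toBlocks₂₂)ᴴ * U.toBlocks₂₂ = (U.toBlocks₁₂)ᴴ * U.toBlocks₁₂ := by
  have h := Matrix.mem_unitaryGroup_iff'.mp hU
  rw [Matrix.star_eq_conjTranspose] at h
  have h22 := congrArg Matrix.toBlocks₂₂ h
  conv_lhs at h22 => rw [← Matrix.fromBlocks_toBlocks U, Matrix.fromBlocks_conjTranspose,
    Matrix.fromBlocks_multiply]
  rw [Matrix.toBlocks_fromBlocks₂₂] at h22
  have h1 : (1 : Matrix (Fin 1 ⊕ Fin R') (Fin 1 ⊕ Fin R') ℂ).toBlocks₂₂ = 1 := by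
    ext i j; simp [Matrix.toBlocks₂₂, Matrix.one_apply]
  rw [h1] at h22
  rw [← h22]
  abel

/-- Dually `CC^* + DD^* = I`: `I − DD^* = CC^*` has rank at most one. [folklore] -/
theorem toBlocks₂₂_defect_eq' {R' : ℕ} {U : Matrix (Fin 1 ⊕ Fin R') (Fin 1 ⊕ Fin R') ℂ}
    (hU : U ∈ Matrix.unitaryGroup (Fin 1 ⊕ Fin R') ℂ) :
    1 - U.toBlocks₂₂ * (U.toBlocks₂₂)ᴴ = U.toBlocks₂₁ * (U.toBlocks₂₁)ᴴ := by
  have h := Matrix.mem_unitaryGroup_iff.mp hU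
  rw [Matrix.star_eq_conjTranspose] at h
  have h22 := congrArg Matrix.toBlocks₂₂ h
  conv_lhs at h22 => rw [← Matrix.fromBlocks_toBlocks U, Matrix.fromBlocks_conjTranspose,
    Matrix.fromBlocks_multiply]
  rw [Matrix.toBlocks_fromBlocks₂₂] at h22
  have h1 : (1 : Matrix (Fin 1 ⊕ Fin R') (Fin 1 ⊕ Fin R') ℂ).toBlocks₂₂ = 1 := by
    ext i j; simp [Matrix.toBlocks₂₂, Matrix.one_apply]
  rw [h1] at h22
  rw [← h22]
  abel


/-! ## Variables of the pencil determinant -/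

/-- The pencil determinant with block structure `κ` is the renaming along `κ` of the pencil
determinant with the tautological block structure `id : Fin R → Fin R`. [folklore] -/
theorem gkvwDet_eq_rename (κ : Fin R → σ) (K : Matrix (Fin R) (Fin R) ℂ) :
    gkvwDet κ K = rename κ (gkvwDet (id : Fin R → Fin R) K) := by
  have hM : (1 - K.map (C : ℂ → MvPolynomial σ ℂ) * blockVar κ) =
      (rename κ : MvPolynomial (Fin R) ℂ →ₐ[ℂ] MvPolynomial σ ℂ).toRingHom.mapMatrix
        (1 - K.map (C : ℂ → MvPolynomial (Fin R) ℂ) * blockVar (id : Fin R → Fin R)) := by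
    ext i j
    by_cases h : i = j
    · subst h
      simp [blockVar, Matrix.mul_diagonal]
    · simp [blockVar, Matrix.mul_diagonal, h]
  rw [gkvwDet_def, gkvwDet_def, hM, ← RingHom.map_det]
  rfl

/-- `det(I − K Z_κ)` involves only the variables `z_{κ(i)}`. [folklore] -/
theorem vars_gkvwDet_subset_image [DecidableEq σ] (κ : Fin R → σ) (K : Matrix (Fin R) (Fin R) ℂ) :
    (gkvwDet κ K).vars ⊆ Finset.univ.image κ := by
  rw [gkvwDet_eq_rename]
  exact (vars_rename κ _).trans (Finset.image_subset_image (Finset.subset_univ _))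

/-- A variable occurring in `det(I − K Z_κ)` is in the range of `κ`. [folklore] -/
theorem mem_range_of_mem_vars_gkvwDet [DecidableEq σ] (κ : Fin R → σ)
    (K : Matrix (Fin R) (Fin R) ℂ) {e : σ} (he : e ∈ (gkvwDet κ K).vars) : e ∈ Set.range κ := by
  obtain ⟨i, -, hi⟩ := Finset.mem_image.mp (vars_gkvwDet_subset_image κ K he)
  exact ⟨i, hi⟩

/-- Over `ℂ` (a domain), a divisor of a nonzero polynomial involves only variables of that
polynomial (`deg_e (p t) = deg_e p + deg_e t`). [folklore] -/
theorem vars_subset_vars_of_dvd {p s : MvPolynomial σ ℂ} (h : p ∣ s) (hs : s ≠ 0) :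
    p.vars ⊆ s.vars := by
  obtain ⟨t, rfl⟩ := h
  have hp : p ≠ 0 := left_ne_zero_of_mul hs
  have ht : t ≠ 0 := right_ne_zero_of_mul hs
  intro e he
  rw [mem_vars_iff_degreeOf_ne_zero] at he ⊢
  rw [degreeOf_mul_eq hp ht]
  omega



end Literature.Analysis.OperatorTheory

end
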